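import Summits.Ventures.Crystal3D.Theorems.StickyWulffConstantCoaxialWallLawTailResidueDefs
import HarnessLib

/-!
# Definitions II: KERNEL-LITERAL rows over the 384 standard placements, and the finite fact `TailResidueCert₂ s`
# (crux `CoaxialWallLaw`, stmt-Ventures-19481, line `WallLedgerF`; cf-p1 DECISION on Defs2 (2026-08-29T02:58:12Z): YES to (i)–(iii))

HONEST FRAMING. Venture `Summits/Ventures/Crystal3D` (cell `crystal3d-full`); DEFINITIONS ONLY for the crux `CoaxialWallLaw`
(stmt-Ventures-19481, `route-Ventures-StickyWulffConstant`), REGISTERED line `WallLedgerF` (planner cf-p1).  Nothing is claimed;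
F-C1 not moved.  AMENDS `…TailResidueDefs` (p690647, which stays as the loose-only special case): the signature rows there
UNDERCOUNT one-letter inclined classes that ≥ 2 RIGID (apex) fillers can fire (an edge apex `y + ⅔(a+b) − c = y + M_μ c` is an
inclined-twin slot position; calc/inclined_classes.py: an inclined NARROW reader needs only 2 apex balls).  Per cf-p1:
(i) the rows are the KERNEL-LITERAL decorated flat summand (all admissible chain classes) of the JOINT plate systems of a STANDARD
PLACEMENT `L₀ ∈ 𝓛` — the `8 × 48 = 384` linear isometries whose slot dozen is the unit set of `Λ₀`, of its basal twin `Λ₀⁻`, or of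
one of the six inclined twins (three of `Λ₀`, three of `Λ₀⁻`); the joint systems `⟨L₀, basalHexagon⟩, ⟨H·L₀, basalHexagon⟩`
dominate the translation and twin systems (`…RowsOfJoint`), so ONE functional `rowJoint` serves all three tails;
(ii) a RIGID filler is an apex POSITION of a core host regardless of edge occupancy; a LOOSE filler sits at no position `q + v`,
`q` a core site, `v` a menu or apex vector; (iii) the junction datum is unchanged.

* `apexVecs` (the `24`… apex vectors over adjacent menu pairs), `Filler.WellFormed₂`, `ResidueType.WellFormed₂`,
  `ResidueType.Realisable₂`;
* `StdFrame L₀` — the placement set 𝓛 (by slot-dozen image);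
* `localSummandFlatDec` (kernel-literal flat multiplicities `endMultFlat` over decorated flat pools), `rowTrans / rowTwin / rowJoint τ L₀`;
* **`TailResidueCert₂ s`** := every well-formed realisable type has `rowJoint τ L₀ ≤ s` for every `L₀ ∈ 𝓛` (cf-p2 PREREG (69.0′));
* **`TailTypeSoundness₂`** — THE T4 TARGET (joint summand form; it implies the translation/twin forms by `…RowsOfJoint`).
COMPUTABILITY: data decidable; rows through the real statistic (exact for sites, apexes, junction balls); evaluator file later.
WHAT THIS IS NOT: no certificate, no soundness proof, no tail theorem; F-C1 not moved.
-/

noncomputable section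

namespace Summit.Ventures.Crystal3D.Theorems

open Summit.Ventures.Crystal3D Finset
open Literature.MathematicalPhysics.StatisticalMechanics (basalMirror fccStacking)
open scoped InnerProductSpace

namespace TailResidue

/-! ### Apex vectors, fillers, well-formedness (ii) -/

open scoped Classical in
/-- The APEX VECTORS: `apexVec a b up` over the ADJACENT pairs of menu vectors (`dsq12 a b = 12`) and both sides. -/
def apexVecs : Finset (EuclideanSpace ℝ (Fin 3)) :=
  (((menuOffsets ×ˢ menuOffsets).filter fun ab => dsq12 ab.1 ab.2 = 12) ×ˢ (Finset.univ : Finset Bool)).image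
    fun p => apexVec (modSite p.1.1) (modSite p.1.2) p.2

/-- Well-formedness II of a filler: a rigid filler is an apex POSITION of an occupied core host within `2` of the payer over an
adjacent menu pair (edge occupancy NOT required); a loose filler has one to three occupied hosts pairwise within `2`, one of them
within `2` of the payer. -/
def Filler.WellFormed₂ (occ : Finset (ℤ × ℤ × ℤ)) : Filler → Prop
  | .rigid y a b _ => y ∈ occ ∧ dsq12 (0, 0, 0) y ≤ 48 ∧ a ∈ menuOffsets ∧ b ∈ menuOffsets ∧ dsq12 a b = 12
  | .loose H => H ⊆ occ ∧ 1 ≤ H.card ∧ H.card ≤ 3 ∧ (∃ y ∈ H, dsq12 (0, 0, 0) y ≤ 48) ∧ ∀ y ∈ H, ∀ t ∈ H, dsq12 y t ≤ 48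

/-- Well-formedness II of a type (as `WellFormed`, with `Filler.WellFormed₂`). -/
def ResidueType.WellFormed₂ (τ : ResidueType) : Prop :=
  τ.occ ⊆ siteBall ∧ ((0, 0, 0) : ℤ × ℤ × ℤ) ∈ τ.occ ∧ (∀ s ∈ τ.occ, ∀ t ∈ τ.occ, s ≠ t → 12 ≤ dsq12 s t) ∧
    (τ.occ.filter fun s => dsq12 (0, 0, 0) s = 12).card ≤ 11 ∧ τ.fillers.length ≤ 3 ∧
    (∀ f ∈ τ.fillers, f.WellFormed₂ τ.occ) ∧
    (match τ.junction with
      | none => True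
      | some J => J.2.2 ⊆ siteBall ∧ J.2.1 ∈ siteBall)

/-- **Realisability II**: the exact balls are `1`-separated; every rigid apex is OFF the module; every loose filler admits a position
at distance `1` from its hosts, `> 1` from every other exact ball, off the module AND at no apex position of a core site (so it is
at no reading position of any standard placement). -/
def ResidueType.Realisable₂ (τ : ResidueType) : Prop :=
  (∀ p ∈ τ.realise, ∀ q ∈ τ.realise, p ≠ q → (1 : ℝ) ≤ dist p q) ∧
  (∀ f ∈ τ.fillers, ∀ x, f.point = some x → x ∉ coaxialModule 1 (Real.sqrt (2 / 3))) ∧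
  (∀ f ∈ τ.fillers, ∀ H, f = Filler.loose H →
    ∃ x : EuclideanSpace ℝ (Fin 3), x ∉ coaxialModule 1 (Real.sqrt (2 / 3)) ∧
      (∀ q ∈ τ.occ, ∀ v ∈ apexVecs, x ≠ modSite q + v) ∧ (∀ h ∈ H, dist x (modSite h) = 1) ∧
      ∀ p ∈ τ.realise, p ∉ H.image modSite → 1 < dist x p)

/-! ### The standard placements (i) -/

/-- **STANDARD PLACEMENT**: a linear isometry whose slot dozen is the unit set of one of the eight lattices readable on a module
window with first-generation apexes — `Λ₀` (`D₊`), its basal twin (`D₋`), the three inclined twins of `D₊` (mirrors `0,1,2` of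
`inclinedNormal`) and the three inclined twins of `D₋` (mirrors `3,4,5`).  `8 × 48 = 384` placements. -/
def StdFrame (L₀ : EuclideanSpace ℝ (Fin 3) ≃ₗᵢ[ℝ] EuclideanSpace ℝ (Fin 3)) : Prop :=
  (L₀ : EuclideanSpace ℝ (Fin 3) → EuclideanSpace ℝ (Fin 3)) '' ↑fccSlots = ↑fccSlots ∨
  (L₀ : EuclideanSpace ℝ (Fin 3) → EuclideanSpace ℝ (Fin 3)) '' ↑fccSlots =
    (basalMirror : EuclideanSpace ℝ (Fin 3) → EuclideanSpace ℝ (Fin 3)) '' ↑fccSlots ∨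
  (∃ c : Fin 6, c.val < 3 ∧ (L₀ : EuclideanSpace ℝ (Fin 3) → EuclideanSpace ℝ (Fin 3)) '' ↑fccSlots =
    (reflectAt (inclinedNormal c) 0) '' ↑fccSlots) ∨
  (∃ c : Fin 6, 3 ≤ c.val ∧ (L₀ : EuclideanSpace ℝ (Fin 3) → EuclideanSpace ℝ (Fin 3)) '' ↑fccSlots =
    (reflectAt (inclinedNormal c) 0) '' ((basalMirror : EuclideanSpace ℝ (Fin 3) → EuclideanSpace ℝ (Fin 3)) '' ↑fccSlots))

/-! ### Kernel-literal decorated rows -/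

open scoped Classical in
/-- **THE DECORATED FLAT SUMMAND, KERNEL-LITERAL**: flat multiplicities `endMultFlat` (ALL admissible chain classes of the two plate
systems) of the exact configuration over decorated flat pools. -/
def localSummandFlatDec (v : WordVersion) (S₁ S₂ : PlateSystem) (P : Finset (EuclideanSpace ℝ (Fin 3)))
    (δ : EuclideanSpace ℝ (Fin 3) → ℕ) (κ : EuclideanSpace ℝ (Fin 3) → ℝ) (z : EuclideanSpace ℝ (Fin 3)) : ℝ :=
  ∑ b ∈ P.filter (fun b => dist z b ≤ 1 ∧ 0 < endMultFlat P v S₁ S₂ b),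
    (endMultFlat P v S₁ S₂ b : ℝ) / pooledDefFlatDec P δ κ b

/-- The translation row of a type at the placement `L₀`. -/
def ResidueType.rowTrans (τ : ResidueType) (L₀ : EuclideanSpace ℝ (Fin 3) ≃ₗᵢ[ℝ] EuclideanSpace ℝ (Fin 3)) : ℝ :=
  localSummandFlatDec WordVersion.v2 ⟨L₀, inPlaneRoots L₀ 1⟩ ⟨L₀, inPlaneRoots L₀ (-1)⟩ τ.realise τ.looseAt τ.fillerCredit 0

/-- The twin row (half-turn form) of a type at the placement `L₀`. -/
def ResidueType.rowTwin (τ : ResidueType) (L₀ : EuclideanSpace ℝ (Fin 3) ≃ₗᵢ[ℝ] EuclideanSpace ℝ (Fin 3)) : ℝ :=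
  localSummandFlatDec WordVersion.v2 ⟨L₀, inPlaneRoots L₀ 1⟩
    ⟨((ℝ ∙ EuclideanSpace.single (2 : Fin 3) (1 : ℝ)).reflection).trans L₀,
      inPlaneRoots (((ℝ ∙ EuclideanSpace.single (2 : Fin 3) (1 : ℝ)).reflection).trans L₀) (-1)⟩
    τ.realise τ.looseAt τ.fillerCredit 0

/-- **The JOINT row** of a type at the placement `L₀` — all six basal roots of `L₀` and of `H·L₀`; it dominates `rowTrans` and
`rowTwin` (the joint systems contain theirs). -/
def ResidueType.rowJoint (τ : ResidueType) (L₀ : EuclideanSpace ℝ (Fin 3) ≃ₗᵢ[ℝ] EuclideanSpace ℝ (Fin 3)) : ℝ :=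
  localSummandFlatDec WordVersion.v2 (basalSystem L₀)
    (basalSystem (((ℝ ∙ EuclideanSpace.single (2 : Fin 3) (1 : ℝ)).reflection).trans L₀)) τ.realise τ.looseAt τ.fillerCredit 0

/-! ### The finite fact and the soundness target -/

/-- **THE TAIL RESIDUE CERTIFICATE II at the line `s`** (cf-p2 PREREG (69.0′)): for every well-formed (II), realisable (II) type and
every standard placement, the joint row is `≤ s`.  Instance of record `s = 2√6`. -/
def TailResidueCert₂ (s : ℝ) : Prop :=
  ∀ τ : ResidueType, τ.WellFormed₂ → τ.Realisable₂ →
    ∀ L₀ : EuclideanSpace ℝ (Fin 3) ≃ₗᵢ[ℝ] EuclideanSpace ℝ (Fin 3), StdFrame L₀ → τ.rowJoint L₀ ≤ s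

open scoped Classical in
/-- **TYPE SOUNDNESS II (THE T4 TARGET)**, joint form: at every payer window of a `1`-separated configuration that is NOT on-site
for 𝒰_cx, either a deletion of inessential balls lands on-site (`HasDeletionOnSite`), or the JOINT summand of the frame `L` is bounded
by the joint row of some well-formed realisable type at some standard placement.  (Contains the generalized class collapse
— every class firing on a module + first-generation-apex window is a class of a standard placement — and the filler bound `3`.)
The translation and twin summands follow by `localSummandA_le_of_systems` (`…RowsOfJoint`). -/
def TailTypeSoundness₂ : Prop :=
  ∀ L : EuclideanSpace ℝ (Fin 3) ≃ₗᵢ[ℝ] EuclideanSpace ℝ (Fin 3),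
  ∀ X : Finset (EuclideanSpace ℝ (Fin 3)), (∀ p ∈ X, ∀ q ∈ X, p ≠ q → 1 ≤ dist p q) →
  ∀ z ∈ X, (X.filter fun q => dist z q = 1).card ≤ 11 → ¬ OnSiteAt coaxialModuleUniverse X z →
    HasDeletionOnSite X z ∨ ∃ τ : ResidueType, τ.WellFormed₂ ∧ τ.Realisable₂ ∧
      ∃ L₀ : EuclideanSpace ℝ (Fin 3) ≃ₗᵢ[ℝ] EuclideanSpace ℝ (Fin 3), StdFrame L₀ ∧
        localSummandA WordVersion.v2 (basalSystem L)
          (basalSystem (((ℝ ∙ EuclideanSpace.single (2 : Fin 3) (1 : ℝ)).reflection).trans L)) X z ≤ τ.rowJoint L₀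

end TailResidue

end Summit.Ventures.Crystal3D.Theorems

end
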